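import Mathlib.Topology.Algebra.OpenSubgroup
import Mathlib.Topology.Algebra.ContinuousMonoidHom
import Mathlib.Algebra.Group.Subgroup.Pointwise
import Mathlib.GroupTheory.GroupAction.ConjAct
import Mathlib.GroupTheory.Index
import Literature.AnabelianGeometry.SemiGraphs.Coverticial
import Literature.AnabelianGeometry.SemiGraphs.CommensurableTerminalityLemmas
import HarnessLib

/-!
# Surface type along finite étale coverings — toolkit: conjugates, closures, transport of
# pro-`Σ` completions ([SemiAnbd] Example 2.10 / Remark 2.4.1)

Mochizuki, *Semi-graphs of anabelioids*, Publ. RIMS **42** (2006), Example 2.10 p. 31 ("each `Π_v`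
is the maximal pro-`Σ` quotient of the fundamental group of a hyperbolic Riemann surface of finite
type, and … each `Π_b → Π_v` is the inclusion morphism of the inertia group of one of the cusps") and
Remark 2.4.1 p. 26 (properties that pass to finite étale coverings `𝒢' → 𝒢`)
[cite: MochizukiSemiAnbd2006, Ex. 2.10 p.31].  PROOF-ONLY plumbing (abc-iut, layer L3, row W4-11
«surface type is stable under finite étale coverings»; no definitions) used by
`SurfaceTypeCoverings.lean` to move the cusp data of abc-iut-L3-t1's interface
`SemiGraphOfAnabelioids.IsOfSurfaceType` along the covering dictionary (`Π_{v'}` = an open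
point-stabiliser `H ⊆ Π_v`, `ι(Π_{b'}) = H ∩ x Π_b x⁻¹`):

* pointwise conjugation of subgroups (`ConjAct`, continuing abc-iut-L6-t17's
  `CommensurableTerminalityLemmas`): versus `map (MulAut.conj γ)`, the identity `K ∩ (kγz)C(kγz)⁻¹ = k (K ∩ γCγ⁻¹) k⁻¹` (`k ∈ K`, `z ∈ C`);
* topological closures of subgroups: under conjugation, under a closed embedding, and the density
  identity `cl(ι X) ∩ H = cl(ι(X ∩ ι⁻¹H))` for an OPEN subgroup `H`;
* transport of `IsProSigmaCompletion Sigma ι` along an isomorphism of topological groups of the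
  completion (`IsProSigmaCompletion.of_continuousMulEquiv_comp`).

Nothing here is specific to the abc programme; nothing takes a side on [IUTchIII] Cor. 3.12.
-/

namespace Literature.AnabelianGeometry.SemiGraphs

open scoped Pointwise
open Topology

/-! ### Conjugates of subgroups -/

section GroupTheory

variable {G G' : Type*} [Group G] [Group G']

/-- The image under `MulAut.conj γ` is the pointwise conjugate (the two spellings of `γSγ⁻¹` used in
the tree). [cite: MochizukiSemiAnbd2006, Ex. 2.10 p.31] -/
theorem map_conj_eq_conjAct_smul (γ : G) (S : Subgroup G) :
    S.map (MulAut.conj γ).toMonoidHom = ConjAct.toConjAct γ • S := by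
  ext x
  simp only [Subgroup.mem_map, MulEquiv.coe_toMonoidHom, MulAut.conj_apply,
    Subgroup.mem_smul_pointwise_iff_exists, ConjAct.smul_def, ConjAct.ofConjAct_toConjAct]

/-- `K ∩ (kγz) C (kγz)⁻¹ = k (K ∩ γ C γ⁻¹) k⁻¹` for `k ∈ K`, `z ∈ C`: a peripheral subgroup seen from `K`
depends only on the double coset `K γ C`, up to `K`-conjugacy. [cite: MochizukiSemiAnbd2006, Ex. 2.10 p.31] -/
theorem inf_conjAct_smul_mul_mul (K C : Subgroup G) {k γ z : G} (hk : k ∈ K) (hz : z ∈ C) :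
    K ⊓ ConjAct.toConjAct (k * γ * z) • C = ConjAct.toConjAct k • (K ⊓ ConjAct.toConjAct γ • C) := by
  rw [Subgroup.smul_inf, conjAct_smul_eq_self_of_mem hk, map_mul, map_mul, mul_smul,
    conjAct_smul_eq_self_of_mem hz, mul_smul]

/-- The image of `X ∩ f⁻¹(H)` is `f(X) ∩ H`. [cite: MochizukiSemiAnbd2006, Ex. 2.10 p.31] -/
theorem map_inf_comap_eq (f : G →* G') (X : Subgroup G) (H : Subgroup G') :
    (X ⊓ H.comap f).map f = X.map f ⊓ H := by
  apply le_antisymm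
  · exact le_inf (Subgroup.map_mono inf_le_left)
      ((Subgroup.map_mono inf_le_right).trans (Subgroup.map_comap_le f H))
  · rintro y ⟨⟨x, hx, rfl⟩, hy⟩
    exact ⟨x, ⟨hx, hy⟩, rfl⟩

end GroupTheory

/-! ### Topological closures of subgroups -/

section Topology

variable {P P' : Type*} [Group P] [TopologicalSpace P] [IsTopologicalGroup P]
  [Group P'] [TopologicalSpace P'] [IsTopologicalGroup P']

/-- Closure commutes with conjugation (conjugation is a homeomorphism).
[cite: MochizukiSemiAnbd2006, Ex. 2.10 p.31] -/
theorem topologicalClosure_conjAct_smul (p : P) (S : Subgroup P) :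
    (ConjAct.toConjAct p • S).topologicalClosure = ConjAct.toConjAct p • S.topologicalClosure := by
  apply SetLike.coe_injective
  have hset : ∀ T : Subgroup P, ((ConjAct.toConjAct p • T : Subgroup P) : Set P) =
      ((Homeomorph.mulRight p⁻¹).trans (Homeomorph.mulLeft p)) '' (T : Set P) := by
    intro T
    ext x
    simp only [Subgroup.coe_pointwise_smul, Set.mem_smul_set, SetLike.mem_coe, ConjAct.smul_def,
      ConjAct.ofConjAct_toConjAct, Set.mem_image, Homeomorph.trans_apply,
      Homeomorph.coe_mulRight, Homeomorph.coe_mulLeft]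
    constructor
    · rintro ⟨s, hs, rfl⟩
      exact ⟨s, hs, by rw [mul_assoc]⟩
    · rintro ⟨s, hs, rfl⟩
      exact ⟨s, hs, by rw [mul_assoc]⟩
  rw [Subgroup.topologicalClosure_coe, hset, hset, Subgroup.topologicalClosure_coe,
    Homeomorph.image_closure]

/-- Closure commutes with a closed embedding of topological groups.
[cite: MochizukiSemiAnbd2006, Ex. 2.10 p.31] -/
theorem topologicalClosure_map_of_isClosedEmbedding (f : P →* P') (hf : IsClosedEmbedding f)
    (S : Subgroup P) : (S.map f).topologicalClosure = S.topologicalClosure.map f := by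
  apply SetLike.coe_injective
  rw [Subgroup.topologicalClosure_coe, Subgroup.coe_map, hf.closure_image_eq, Subgroup.coe_map,
    Subgroup.topologicalClosure_coe]

/-- **Density identity.**  For `ι : Γ → P` and an OPEN subgroup `H ⊆ P`:
`cl(ι X) ∩ H = cl(ι(X ∩ ι⁻¹ H))` — the open set `H` meets the closure of `ι X` only in the closure of
`ι X ∩ H`. [cite: MochizukiSemiAnbd2006, Ex. 2.10 p.31] -/
theorem topologicalClosure_map_inf_of_isOpen {Γ : Type*} [Group Γ] (ι : Γ →* P) (X : Subgroup Γ)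
    (H : Subgroup P) (hH : IsOpen (H : Set P)) :
    (X.map ι).topologicalClosure ⊓ H = ((X ⊓ H.comap ι).map ι).topologicalClosure := by
  apply le_antisymm
  · intro x hx
    obtain ⟨hx₁, hx₂⟩ := Subgroup.mem_inf.mp hx
    have h₁ : x ∈ closure ((X.map ι : Subgroup P) : Set P) := by
      rw [← Subgroup.topologicalClosure_coe]; exact hx₁
    have h₂ : x ∈ closure (((X.map ι : Subgroup P) : Set P) ∩ (H : Set P)) :=
      hH.closure_inter ⟨h₁, hx₂⟩
    rw [← Subgroup.coe_inf, ← map_inf_comap_eq, ← Subgroup.topologicalClosure_coe] at h₂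
    exact h₂
  · apply le_inf
    · exact Subgroup.topologicalClosure_mono (Subgroup.map_mono inf_le_left)
    · exact Subgroup.topologicalClosure_minimal _
        ((Subgroup.map_mono inf_le_right).trans (Subgroup.map_comap_le ι H))
        (H.isClosed_of_isOpen hH)

end Topology

/-! ### Transport of pro-`Σ` completions along an isomorphism of topological groups -/

namespace SemiGraphOfAnabelioids.IsProSigmaCompletion

variable {Sigma : Set ℕ} {Γ : Type*} [Group Γ] {P P' : Type*} [Group P] [TopologicalSpace P]
  [Group P'] [TopologicalSpace P'] {ι : Γ →* P}

/-- **Transport along an isomorphism of the completion.**  If `ι : Γ → P` exhibits `P` as the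
pro-`Σ` completion of `Γ` and `f : P ≃ P'` is an isomorphism of topological groups, then
`f ∘ ι : Γ → P'` exhibits `P'` as the pro-`Σ` completion of `Γ` (dense image, `Σ`-indices of open
normal subgroups and pulled-back open subgroups are transported along `f`).
[cite: MochizukiSemiAnbd2006, Ex. 2.10 p.31] -/
theorem of_continuousMulEquiv_comp (hι : IsProSigmaCompletion Sigma ι) (f : P ≃ₜ* P') :
    IsProSigmaCompletion Sigma (f.toMulEquiv.toMonoidHom.comp ι) where
  dense := by
    have h : DenseRange (f ∘ ι) := f.surjective.denseRange.comp hι.dense f.continuous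
    exact h
  index_open N hN hNo := by
    haveI := hN
    have h := hι.index_open (N.comap f.toMulEquiv.toMonoidHom) inferInstance
      (hNo.preimage f.continuous)
    rwa [Subgroup.index_comap_of_surjective N (f := f.toMulEquiv.toMonoidHom) f.surjective] at h
  comap_surj N hN hNi := by
    obtain ⟨U, hUo, hU⟩ := hι.comap_surj N hN hNi
    refine ⟨U.comap f.symm.toMulEquiv.toMonoidHom, hUo.preimage f.symm.continuous, ?_⟩
    rw [← hU]
    ext x
    simp only [Subgroup.mem_comap, MonoidHom.coe_comp, Function.comp_apply,
      MulEquiv.coe_toMonoidHom]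
    rw [show f.symm.toMulEquiv (f.toMulEquiv (ι x)) = ι x from f.symm_apply_apply (ι x)]

end SemiGraphOfAnabelioids.IsProSigmaCompletion

end Literature.AnabelianGeometry.SemiGraphs
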